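import Summits.QuantumFields.BalabanUV.T4Continuum.Support.NE7FlatSliceSourceDuality
import Summits.QuantumFields.BalabanUV.T4Continuum.Support.NE7FlatSliceNormalForm
import Summits.QuantumFields.BalabanUV.T4Continuum.Support.NE7FlatSliceStraightReduction
import Summits.QuantumFields.BalabanUV.T4Continuum.Support.NE7FlatSliceRankOne
import HarnessLib

/-!
# NE7FlatSliceChain — row NE7 (node U5), the (A)-bill's XL(c) driver AS ONE DISPLAYED LETTER ABOUT ONE IMAGINARY SCALAR FIELD: the END's slice solver
# letter `G♭` (F54 v3's `hG`, in dimension `d+1`, period `L^(k+1)·N`) from the RANK-ONE STRAIGHT SOURCE LETTER — the chain 141 → 139 → 137 composed,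
# with the END's side conditions discharged

Lineage `b2b-balaban-t4-ne7-p2` (CRUX PROVER NE7 #2, co-owner of row NE7), generation 84 (staged; filed when (137) ∕ (139) ∕ (141) are BUILT); memo
`t4/b2b-balaban-t4-ne7-p2/g84/XLC-DOCKING-MEMO.md` §7.  Over (138) `NE7FlatSliceNormalForm` (uniqueness core, factorisation engine), (137) `NE7FlatSliceSourceDuality.exists_skewSource_of_l1DualBound` (the ℓ¹–ℓ^∞ duality engine, any real
subspace of skew periodic fields), (139) `NE7FlatSliceStraightReduction.sliceSolver_of_straightSliceSolver` (END slice ⟸ straight slice, constant `(1 + 2d·C_fr)`, all `j, N`),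
(141) `NE7FlatSliceRankOne.straightSliceSolver_of_rankOne` (rank `n` ⟸ rank one, constant `2n³`).
WHAT.  §1 the straight slice `straightSlice L j P = {skew, P-periodic, (Qcoarse L)^[j] · = 0}` as a real subspace (closure by `NE3FramePotGauge.iterate_Qcoarse_add`,
`NE3FramePotBoundComplex.iterate_Qcoarse_map`); **`straightSliceSolver_of_straightSourceSolver`**: the straight FUNCTIONAL letter ⟸ the straight SOURCE letter, constant
`card n · K` (137's engine on the straight slice).  §2 **`sliceSolver_of_rankOneSourceSolver`**: the END-shaped letter `hG′` on `{skew, P-periodic, dirIter L j 1 · = 0}` for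
`Matrix n n ℂ`-valued fields, `P = L^j·N`, from the RANK-ONE STRAIGHT SOURCE LETTER with constant `K₁`:
`K_G = (1 + 2d·C_fr(d, L))·(2·n³·K₁)` (`d ≥ 2`, `L ≥ 2`, `(L^j)^d ≥ 2`, `N ≥ 1`).  §3 **`sliceSolver_end_of_rankOneSourceSolver`**: the same at the END's parameters —
dimension `d + 1` with `1 ≤ d`, `2 ≤ L`, `j = k + 1`, `P = L^(k+1)·N` — the side conditions `2 ≤ d+1` and `2 ≤ (L^(k+1))^(d+1)` discharged.  §4 the supplier's bookkeeping ON THE STRAIGHT SLICE ((138) transported): **`curlAt_flat_eq_of_straightSliceIdentity`** (two straight-slice solutions of one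
identity have the same flat curl) and **`exists_multiplier_of_straightSliceIdentity`** (the straight slice identity ⟺ a Lagrange identity `hess 1 X Y = ℓ Y + μ ((Qcoarse L)^[j] Y)`
on all skew periodic `Y`).
SO THE XL(c) DRIVER IS, EXACTLY: for ONE purely imaginary scalar field `ξ` on the unit torus of side `L^(k+1)N` in dimension `d+1` with zero `L^(k+1)`-block LINE MEANS, every
skew periodic rank-one SOURCE `h` with `‖h‖ ≤ g` representing the flat Hessian functional of `ξ` on that straight slice forces `‖curlAt 1 ξ‖ ≤ K₁·g`, `K₁ = K₁′(d, L)·L^(k+1)` —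
the TYPE of lit-balaban's `B5Prop12GHolds.global115_117_famG_printed` entry (1.115)₂ read through the chart of memo §7 (file D5, the OWNER's).
HONEST FRAMING (page 1): [folklore] composition; NO estimate; the rank-one source letter `h1src` is a DISPLAYED HYPOTHESIS (the XL(c) content, PRICING-NE7: critical, unprinted ∕
unproved); nothing of Bałaban's asserted; NOT (APE), NOT ONE-STEP, NOT NE7; spine 0∕9; finite T⁴ rung (B)+1 — NOT infinite volume, NOT mass gap, NOT Clay.  Continuum YM on T⁴ ⇐
BetaPertH ∧ nine spine estimates (0/9 proved); BetaPertH ⇐ (D1) ∧ (D4) ∧ CAP+tail; G-an2-4 gates asym, D1 and NE2/3/4.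
-/

set_option autoImplicit false

open scoped BigOperators Matrix Matrix.Norms.L2Operator
open NormedSpace Finset

namespace Summit.QuantumFields.BalabanUV.T4Continuum.NE7FlatSliceChain

open Literature.MathematicalPhysics.QuantumFieldTheory.Balaban1983to89
open B7Prop1Explicit B7Prop2Explicit UnitaryModel
open T4AveragingDeficitWall hiding Site Plane Plaq Bond
open T4AveragingDeficitWallBoundary (periodBox)
open AveragingDeficitPeriodicCounting (IsPeriodicDir)
open MinimalActionLevels (perWin)
open BlockAveragePushDirSplit (flat)
open NE3HessForm (hess)
open NE3TangentCovariantTower (dirIter)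
open NE3EnergyHessBilin (hessBilin hessBilin_apply)
open NE3TangentFlatStructure (Qcoarse)
open NE3FramePotGauge (iterate_Qcoarse_add)
open NE3FramePotBoundComplex (iterate_Qcoarse_map)
open NE7FlatSliceSourceDuality (srcPair exists_skewSource_of_l1DualBound abs_srcPair_le)
open NE7FlatSliceStraightReduction (Cfr sliceSolver_of_straightSliceSolver)
open NE7FlatSliceRankOne (straightSliceSolver_of_rankOne)
open NE7FlatSliceNormalForm (curlAt_flat_eq_zero_of_hess_self_eq_zero exists_factor_of_ker_le)

noncomputable section

variable {d : ℕ} {n : Type*} [Fintype n] [DecidableEq n]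

local notation "𝕄₁" => Matrix (Fin 1) (Fin 1) ℂ

/-! ## §1 The straight slice as a real subspace; the straight functional letter from the straight source letter -/

omit [Fintype n] [DecidableEq n] in
/-- A real multiple of a matrix field read through the complex structure. [folklore] -/
theorem real_smul_eq_map (c : ℝ) (Y : Site d → Fin d → Matrix n n ℂ) :
    c • Y = fun y μ => ((c : ℂ) • (LinearMap.id : Matrix n n ℂ →ₗ[ℂ] Matrix n n ℂ)) (Y y μ) := by
  funext y μ; ext i k
  simp only [Pi.smul_apply, Matrix.smul_apply, Complex.real_smul, LinearMap.smul_apply, LinearMap.id_coe, id_eq, smul_eq_mul]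

/-- **BAŁABAN's STRAIGHT SLICE AS A REAL SUBSPACE**: skew, `P`-periodic direction fields with vanishing `j`-fold straight average `(Qcoarse L)^[j]`. [folklore] -/
def straightSlice (L j P : ℕ) : Submodule ℝ (Site d → Fin d → Matrix n n ℂ) where
  carrier := {Y | IsSkewDir Y ∧ IsPeriodicDir Y (P : ℤ) ∧ (Qcoarse L)^[j] Y = 0}
  add_mem' := by
    rintro Y Z ⟨hYs, hYP, hYQ⟩ ⟨hZs, hZP, hZQ⟩
    refine ⟨fun x κ => (skewAdjoint _).add_mem (hYs x κ) (hZs x κ), fun x κ μ => ?_, ?_⟩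
    · show Y (x + (P : ℤ) • e κ) μ + Z (x + (P : ℤ) • e κ) μ = Y x μ + Z x μ
      rw [hYP, hZP]
    · rw [show Y + Z = fun y μ => Y y μ + Z y μ from rfl, iterate_Qcoarse_add, hYQ, hZQ]
      funext z κ; simp only [Pi.zero_apply, add_zero]
  zero_mem' := by
    refine ⟨fun x κ => (skewAdjoint _).zero_mem, fun x κ μ => rfl, ?_⟩
    have h := iterate_Qcoarse_map ((0 : ℂ) • (LinearMap.id : Matrix n n ℂ →ₗ[ℂ] Matrix n n ℂ)) L j (0 : Site d → Fin d → Matrix n n ℂ)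
    simp only [zero_smul, LinearMap.zero_apply] at h
    exact h
  smul_mem' := by
    rintro c Y ⟨hYs, hYP, hYQ⟩
    refine ⟨fun x κ => skewAdjoint.smul_mem c (hYs x κ), fun x κ μ => ?_, ?_⟩
    · show c • Y (x + (P : ℤ) • e κ) μ = c • Y x μ
      rw [hYP]
    · rw [real_smul_eq_map, iterate_Qcoarse_map, hYQ]
      funext z κ; simp only [Pi.zero_apply, map_zero]

/-- **THE STRAIGHT FUNCTIONAL LETTER FROM THE STRAIGHT SOURCE LETTER** (137's engine on the straight slice): constant `card n · K`. [folklore] -/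
theorem straightSliceSolver_of_straightSourceSolver (L j P : ℕ) [NeZero P] {K : ℝ}
    (hSrc : ∀ X : Site d → Fin d → Matrix n n ℂ, IsSkewDir X → IsPeriodicDir X (P : ℤ) → (Qcoarse L)^[j] X = 0 →
      ∀ H : Site d → Fin d → Matrix n n ℂ, IsSkewDir H → IsPeriodicDir H (P : ℤ) → ∀ g : ℝ, 0 ≤ g → (∀ (x : Site d) (κ : Fin d), ‖H x κ‖ ≤ g) →
      (∀ Y : Site d → Fin d → Matrix n n ℂ, IsSkewDir Y → IsPeriodicDir Y (P : ℤ) → (Qcoarse L)^[j] Y = 0 →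
        hess (flat (d := d) (n := n)) X Y (perWin d P) = srcPair H Y (periodBox (d := d) P)) →
      ∀ (z : Site d) (μ ν : Fin d), μ ≠ ν → ‖curlAt (flat (d := d) (n := n)) X z μ ν‖ ≤ K * g) :
    ∀ X : Site d → Fin d → Matrix n n ℂ, IsSkewDir X → IsPeriodicDir X (P : ℤ) → (Qcoarse L)^[j] X = 0 → ∀ g : ℝ, 0 ≤ g →
      (∀ Y : Site d → Fin d → Matrix n n ℂ, IsSkewDir Y → IsPeriodicDir Y (P : ℤ) → (Qcoarse L)^[j] Y = 0 →
        |hess (flat (d := d) (n := n)) X Y (perWin d P)| ≤ g * dirL1 Y (periodBox (d := d) P)) →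
      ∀ (z : Site d) (μ ν : Fin d), μ ≠ ν → ‖curlAt (flat (d := d) (n := n)) X z μ ν‖ ≤ (Fintype.card n * K) * g := by
  intro X hXs hXP hXQ g hg hfun z μ ν hμν
  obtain ⟨H, hHs, hHP, hHb, hrep⟩ := exists_skewSource_of_l1DualBound P (straightSlice (d := d) (n := n) L j P) (fun Y hY => hY.1)
    (fun Y hY => hY.2.1) (hessBilin (flat (d := d) (n := n)) (perWin d P) X) hg
    (fun Y hY => by rw [hessBilin_apply]; exact hfun Y hY.1 hY.2.1 hY.2.2)
  have h := hSrc X hXs hXP hXQ H hHs hHP (Fintype.card n * g) (by positivity) hHb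
    (fun Y hYs hYP hYQ => by rw [← hessBilin_apply]; exact hrep Y ⟨hYs, hYP, hYQ⟩) z μ ν hμν
  calc ‖curlAt (flat (d := d) (n := n)) X z μ ν‖ ≤ K * (Fintype.card n * g) := h
    _ = Fintype.card n * K * g := by ring

/-! ## §2 The END-shaped letter from the rank-one straight source letter -/

/-- **`sliceSolver_of_rankOneSourceSolver`**: HYPOTHESIS `h1src` (DISPLAYED; the XL(c) content): the SOURCE letter with constant `K₁` on the rank-one straight slice
(`Matrix (Fin 1) (Fin 1) ℂ`-valued skew `P`-periodic fields with `(Qcoarse L)^[j] · = 0`, skew periodic rank-one sources).  CONCLUSION: the END's letter `hG′` on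
`{skew, P-periodic, dirIter L j 1 · = 0}` for `Matrix n n ℂ`-valued fields, `P = L^j·N`, with `K_G = (1 + 2d·C_fr(d,L))·(2·n³·K₁)`. [folklore] -/
theorem sliceSolver_of_rankOneSourceSolver [Nonempty n] (hd : 2 ≤ d) {L : ℕ} (hL : 2 ≤ L) {j N : ℕ} (hN : 1 ≤ N) (hMd : 2 ≤ (L ^ j) ^ d) {K₁ : ℝ}
    (h1src : ∀ ξ : Site d → Fin d → 𝕄₁, IsSkewDir ξ → IsPeriodicDir ξ ((L ^ j * N : ℕ) : ℤ) → (Qcoarse L)^[j] ξ = 0 →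
      ∀ h : Site d → Fin d → 𝕄₁, IsSkewDir h → IsPeriodicDir h ((L ^ j * N : ℕ) : ℤ) → ∀ g : ℝ, 0 ≤ g → (∀ (x : Site d) (κ : Fin d), ‖h x κ‖ ≤ g) →
      (∀ ζ : Site d → Fin d → 𝕄₁, IsSkewDir ζ → IsPeriodicDir ζ ((L ^ j * N : ℕ) : ℤ) → (Qcoarse L)^[j] ζ = 0 →
        hess (flat (d := d) (n := Fin 1)) ξ ζ (perWin d (L ^ j * N)) = srcPair h ζ (periodBox (d := d) (L ^ j * N))) →
      ∀ (z : Site d) (μ ν : Fin d), μ ≠ ν → ‖curlAt (flat (d := d) (n := Fin 1)) ξ z μ ν‖ ≤ K₁ * g) :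
    ∀ X : Site d → Fin d → Matrix n n ℂ, IsSkewDir X → IsPeriodicDir X ((L ^ j * N : ℕ) : ℤ) → dirIter L j (flat (d := d) (n := n)) X = 0 → ∀ g : ℝ, 0 ≤ g →
      (∀ Y : Site d → Fin d → Matrix n n ℂ, IsSkewDir Y → IsPeriodicDir Y ((L ^ j * N : ℕ) : ℤ) → dirIter L j (flat (d := d) (n := n)) Y = 0 →
        |hess (flat (d := d) (n := n)) X Y (perWin d (L ^ j * N))| ≤ g * dirL1 Y (periodBox (d := d) (L ^ j * N))) →
      ∀ (z : Site d) (μ ν : Fin d), μ ≠ ν →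
        ‖curlAt (flat (d := d) (n := n)) X z μ ν‖ ≤ ((1 + 2 * d * Cfr d L) * (2 * (Fintype.card n : ℝ) ^ 3 * K₁)) * g := by
  haveI : NeZero (L ^ j * N) := ⟨by positivity⟩
  -- rank one: source ⟹ functional (constant `card (Fin 1) · K₁ = K₁`)
  have h1 := straightSliceSolver_of_straightSourceSolver (d := d) (n := Fin 1) L j (L ^ j * N) h1src
  rw [Fintype.card_fin, Nat.cast_one, one_mul] at h1
  -- rank one ⟹ rank n (constant `2n³K₁`), then straight ⟹ END slice
  exact sliceSolver_of_straightSliceSolver hd hL hN hMd (straightSliceSolver_of_rankOne L j (L ^ j * N) h1)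

/-! ## §3 At the END's parameters: dimension `d + 1`, `j = k + 1`, `P = L^(k+1)·N` -/

/-- **THE XL(c) DRIVER AS ONE LETTER, AT THE END's PARAMETERS** (`sliceSolver_end_of_rankOneSourceSolver`): F54 v3's `hG` (dimension `d+1`, `1 ≤ d`, `2 ≤ L`, period
`L^(k+1)·N`, `[NeZero N]`) from the rank-one straight source letter, with `K_G = (1 + 2(d+1)·C_fr(d+1, L))·(2·n³·K₁)`; the side conditions of (139) hold automatically. [folklore] -/
theorem sliceSolver_end_of_rankOneSourceSolver [Nonempty n] (hd : 1 ≤ d) {L N : ℕ} [NeZero N] (hL : 2 ≤ L) (k : ℕ) {K₁ : ℝ}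
    (h1src : ∀ ξ : Site (d + 1) → Fin (d + 1) → 𝕄₁, IsSkewDir ξ → IsPeriodicDir ξ ((L ^ (k + 1) * N : ℕ) : ℤ) → (Qcoarse L)^[k + 1] ξ = 0 →
      ∀ h : Site (d + 1) → Fin (d + 1) → 𝕄₁, IsSkewDir h → IsPeriodicDir h ((L ^ (k + 1) * N : ℕ) : ℤ) → ∀ g : ℝ, 0 ≤ g →
      (∀ (x : Site (d + 1)) (κ : Fin (d + 1)), ‖h x κ‖ ≤ g) →
      (∀ ζ : Site (d + 1) → Fin (d + 1) → 𝕄₁, IsSkewDir ζ → IsPeriodicDir ζ ((L ^ (k + 1) * N : ℕ) : ℤ) → (Qcoarse L)^[k + 1] ζ = 0 →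
        hess (flat (d := d + 1) (n := Fin 1)) ξ ζ (perWin (d + 1) (L ^ (k + 1) * N)) = srcPair h ζ (periodBox (d := d + 1) (L ^ (k + 1) * N))) →
      ∀ (z : Site (d + 1)) (μ ν : Fin (d + 1)), μ ≠ ν → ‖curlAt (flat (d := d + 1) (n := Fin 1)) ξ z μ ν‖ ≤ K₁ * g) :
    ∀ X : Site (d + 1) → Fin (d + 1) → Matrix n n ℂ, IsSkewDir X → IsPeriodicDir X ((L ^ (k + 1) * N : ℕ) : ℤ) →
      dirIter L (k + 1) (flat (d := d + 1) (n := n)) X = 0 → ∀ g : ℝ, 0 ≤ g →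
      (∀ Y : Site (d + 1) → Fin (d + 1) → Matrix n n ℂ, IsSkewDir Y → IsPeriodicDir Y ((L ^ (k + 1) * N : ℕ) : ℤ) →
        dirIter L (k + 1) (flat (d := d + 1) (n := n)) Y = 0 →
        |hess (flat (d := d + 1) (n := n)) X Y (perWin (d + 1) (L ^ (k + 1) * N))| ≤ g * dirL1 Y (periodBox (d := d + 1) (L ^ (k + 1) * N))) →
      ∀ (z : Site (d + 1)) (μ ν : Fin (d + 1)), μ ≠ ν →
        ‖curlAt (flat (d := d + 1) (n := n)) X z μ ν‖ ≤ ((1 + 2 * ((d + 1 : ℕ) : ℝ) * Cfr (d + 1) L) * (2 * (Fintype.card n : ℝ) ^ 3 * K₁)) * g := by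
  have hN : 1 ≤ N := Nat.one_le_iff_ne_zero.mpr (NeZero.ne N)
  have hMd : 2 ≤ (L ^ (k + 1)) ^ (d + 1) :=
    calc 2 ≤ L := hL
      _ = L ^ 1 := (pow_one L).symm
      _ ≤ L ^ ((k + 1) * (d + 1)) := Nat.pow_le_pow_right (by omega) (Nat.one_le_iff_ne_zero.mpr (by positivity))
      _ = (L ^ (k + 1)) ^ (d + 1) := pow_mul L (k + 1) (d + 1)
  have h := sliceSolver_of_rankOneSourceSolver (d := d + 1) (n := n) (by omega) hL hN hMd h1src
  push_cast at h ⊢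
  exact h

/-! ## §4 The supplier's bookkeeping on the straight slice: uniqueness of the flat curl, Lagrange normal form -/

/-- The `j`-fold straight average as a real linear map. [folklore] -/
def iterateQcoarseL (L j : ℕ) : (Site d → Fin d → Matrix n n ℂ) →ₗ[ℝ] (Site d → Fin d → Matrix n n ℂ) where
  toFun Y := (Qcoarse L)^[j] Y
  map_add' Y Z := by rw [show Y + Z = fun y μ => Y y μ + Z y μ from rfl, iterate_Qcoarse_add]; rfl
  map_smul' c Y := by rw [RingHom.id_apply, real_smul_eq_map, iterate_Qcoarse_map, real_smul_eq_map c ((Qcoarse L)^[j] Y)]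

/-- unfolding. [folklore] -/
@[simp] theorem iterateQcoarseL_apply (L j : ℕ) (Y : Site d → Fin d → Matrix n n ℂ) : iterateQcoarseL (d := d) (n := n) L j Y = (Qcoarse L)^[j] Y := rfl

/-- **UNIQUENESS OF THE FLAT CURL ON THE STRAIGHT SLICE**: two fields of `{skew, P-periodic, (Qcoarse L)^[j] · = 0}` whose flat Hessian functionals agree on that slice have
the same flat curl at every plaquette ((138)'s core on Bałaban's constraint) — a supplier bounds the curl of HIS solution. [folklore] -/
theorem curlAt_flat_eq_of_straightSliceIdentity (L j P : ℕ) [NeZero P] (ℓ : (Site d → Fin d → Matrix n n ℂ) → ℝ)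
    {X X' : Site d → Fin d → Matrix n n ℂ} (hX : X ∈ straightSlice (d := d) (n := n) L j P) (hX' : X' ∈ straightSlice (d := d) (n := n) L j P)
    (hXℓ : ∀ Y ∈ straightSlice (d := d) (n := n) L j P, hess (flat (d := d) (n := n)) X Y (perWin d P) = ℓ Y)
    (hX'ℓ : ∀ Y ∈ straightSlice (d := d) (n := n) L j P, hess (flat (d := d) (n := n)) X' Y (perWin d P) = ℓ Y)
    (z : Site d) (μ ν : Fin d) : curlAt (flat (d := d) (n := n)) X z μ ν = curlAt (flat (d := d) (n := n)) X' z μ ν := by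
  have hD : X - X' ∈ straightSlice (d := d) (n := n) L j P := Submodule.sub_mem _ hX hX'
  have h0 : hess (flat (d := d) (n := n)) (X - X') (X - X') (perWin d P) = 0 := by
    have e := map_sub (hessBilin (flat (d := d) (n := n)) (perWin d P)) X X'
    rw [← hessBilin_apply, e, LinearMap.sub_apply, hessBilin_apply, hessBilin_apply, hXℓ _ hD, hX'ℓ _ hD, sub_self]
  have h := curlAt_flat_eq_zero_of_hess_self_eq_zero hD.1 hD.2.1 h0 z μ ν
  rw [sub_eq_add_neg X X', NE3EnergyHessBilin.curlAt_add, ← neg_one_smul ℝ X', NE3EnergyHessBilin.curlAt_smul, neg_one_smul, ← sub_eq_add_neg] at h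
  exact sub_eq_zero.mp h

/-- **THE LAGRANGE NORMAL FORM ON THE STRAIGHT SLICE**: the straight slice identity of `X` against a real linear functional `ℓ` reads, on ALL skew `P`-periodic `Y`,
`hess 1 X Y W = ℓ Y + μ ((Qcoarse L)^[j] Y)` for one real linear functional `μ` — the weak form of `δdX = H + Qᵀμ` with BAŁABAN's `Q` ((1.18)). [folklore] -/
theorem exists_multiplier_of_straightSliceIdentity (L j P : ℕ) (X : Site d → Fin d → Matrix n n ℂ)
    (ℓ : (Site d → Fin d → Matrix n n ℂ) →ₗ[ℝ] ℝ) (W : Finset (T4AveragingDeficitWall.Plaq d))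
    (hX : ∀ Y : Site d → Fin d → Matrix n n ℂ, IsSkewDir Y → IsPeriodicDir Y (P : ℤ) → (Qcoarse L)^[j] Y = 0 → hess (flat (d := d) (n := n)) X Y W = ℓ Y) :
    ∃ μ : (Site d → Fin d → Matrix n n ℂ) →ₗ[ℝ] ℝ, ∀ Y : Site d → Fin d → Matrix n n ℂ, IsSkewDir Y → IsPeriodicDir Y (P : ℤ) →
      hess (flat (d := d) (n := n)) X Y W = ℓ Y + μ ((Qcoarse L)^[j] Y) := by
  obtain ⟨μ, hμ⟩ := exists_factor_of_ker_le (NE7FlatSliceNormalForm.skewPeriodicDir (d := d) (n := n) P) (iterateQcoarseL (d := d) (n := n) L j)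
    (hessBilin (flat (d := d) (n := n)) W X - ℓ) (fun Y hY hT => by rw [LinearMap.sub_apply, hessBilin_apply, hX Y hY.1 hY.2 hT, sub_self])
  refine ⟨μ, fun Y hYs hYP => ?_⟩
  have h := hμ Y ⟨hYs, hYP⟩
  rw [LinearMap.sub_apply, hessBilin_apply, iterateQcoarseL_apply] at h
  linarith

end

end Summit.QuantumFields.BalabanUV.T4Continuum.NE7FlatSliceChain
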